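import Summits.ResolutionOfSingularities.ResolutionOfSingularities.Theorems.ValuativeLuAlphaPTorsorBirationalExit
import Literature.AlgebraicGeometry.Resolution.ValuedFunctionFields
import Mathlib.FieldTheory.KummerPolynomial
import Mathlib.RingTheory.PowerBasis
import Mathlib.RingTheory.Adjoin.Polynomial.Basic
import Mathlib.Algebra.Polynomial.RingDivision
import HarnessLib

/-!
# The residue step of an `α_p`-tower for the crux `Valuative.LuAlphaPTorsor`
# (stmt-ResolutionOfSingularities-0641): stub `stub_residueStep`

Crux `Valuative.LuAlphaPTorsor` (item `stmt-ResolutionOfSingularities-0641`), line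
`pfaff-line-log-final-forms`, registered stub `stub_residueStep` (S5 of reshape v6).

Setting: `k ⊆ K` fields, `O` a valuation ring of `K`, `R ⊆ O` a finitely generated
`k`-subalgebra of `K` with `x₁, …, xₙ ∈ R` GENERATING the centre `𝔪_O ∩ R` (a "very good
chart"), `t ∈ K` with `t ^ p = u ∈ R`, `v(u) = 1`, and `v(u - c ^ p) = 1` for every
`c ∈ O ∩ Frac R` (the residue `ū` is not a `p`-th power in the residue field `κ_M` of
`M = Frac R`).

**Claim** (`stub_residueStep`, the residue step, inertia `f = p`). `R' := R[t]` with the same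
parameters `x` is again a very good chart: finitely generated, `R ≤ R' ∋ t`, `R' ⊆ O`,
`R' ⊆ Frac R (t)`, and the centre `𝔪_O ∩ R'` is generated by the `xᵢ`.

Proof.
0. `v(t) ^ p = v(u) = 1`, so `v(t) = 1` and `t ∈ O`.
1. `t` is integral over `R` (`T ^ p - u`), so every `z ∈ R[t]` is `∑_{i<p} rᵢ tⁱ` with
   `rᵢ ∈ R` (`Algebra.adjoin_singleton_eq_range_aeval` and division with remainder by the
   monic `T ^ p - u`).
2. In the residue field `κ` of `O` let `κ_M := resField O (Frac R)`; `ū ∈ κ_M` is not a `p`-th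
   power of an element of `κ_M` (hypothesis), so `X ^ p - ū` is irreducible over `κ_M`
   (`X_pow_sub_C_irreducible_of_prime`, any characteristic), hence the minimal polynomial of
   `t̄`, and `1, t̄, …, t̄^{p-1}` are linearly independent over `κ_M` (`linearIndependent_pow`).
3. If `z = ∑_{i<p} rᵢ tⁱ ∈ 𝔪_O` then `∑ r̄ᵢ t̄ⁱ = 0` with `r̄ᵢ ∈ κ_M`, so all `r̄ᵢ = 0`, i.e.
   every `rᵢ` lies in the centre of `R`, which is `(x) R`; hence `z ∈ (x) R'`. The other
   inclusion is `v(xᵢ) < 1`.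
4. `R'` is finitely generated (one more generator), `R' ⊆ O` (`t ∈ O`), `R' ⊆ Frac R (t)`.
-/

-- single-problem summit: the doubled namespace component `ResolutionOfSingularities` is forced
set_option linter.dupNamespace false

namespace Summit.ResolutionOfSingularities.ResolutionOfSingularities.Theorems.PfaffLine

open IsLocalRing Literature.AlgebraicGeometry.Resolution Polynomial

section Helpers

variable {k K : Type} [Field k] [Field K] [Algebra k K]

/-- Membership in the centre `𝔪_O ∩ S` of a subalgebra `S ⊆ O`:
`a ∈ 𝔪_O ∩ S ↔ v(a) < 1`. [folklore] -/
theorem residueStep_mem_centre_iff (O : ValuationSubring K) (S : Subalgebra k K)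
    (h : S.toSubring ≤ O.toSubring) (a : S.toSubring) :
    a ∈ Ideal.comap (Subring.inclusion h) (maximalIdeal O) ↔ O.valuation (a : K) < 1 := by
  rw [Ideal.mem_comap, ValuationSubring.valuation_lt_one_iff]
  rfl

/-- **Expansion in powers of `t`.** If `t ^ p ∈ R` (`p ≠ 0`), every element of
`R[t] = Algebra.adjoin k (insert t R)` is `∑_{i<p} rᵢ tⁱ` with `rᵢ ∈ R` (division with
remainder by the monic `X ^ p - t ^ p ∈ R[X]`). [folklore] -/
theorem residueStep_exists_sum_eq (R : Subalgebra k K) {p : ℕ} (hp : p ≠ 0) {t : K}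
    (ht : t ^ p ∈ R) {z : K} (hz : z ∈ Algebra.adjoin k (insert t (R : Set K))) :
    ∃ r : Fin p → K, (∀ i, r i ∈ R) ∧ z = ∑ i, r i * t ^ (i : ℕ) := by
  have hz' : z ∈ Algebra.adjoin R {t} := by
    have hle : Algebra.adjoin k (insert t (R : Set K)) ≤
        (Algebra.adjoin R {t}).restrictScalars k := by
      refine Algebra.adjoin_le fun y hy => ?_
      rw [SetLike.mem_coe, Subalgebra.mem_restrictScalars]
      rcases Set.mem_insert_iff.mp hy with h | h
      · rw [h]
        exact Algebra.self_mem_adjoin_singleton _ t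
      · have hmem := (Algebra.adjoin R {t}).algebraMap_mem (⟨y, h⟩ : R)
        rwa [Subalgebra.algebraMap_apply] at hmem
    exact (Subalgebra.mem_restrictScalars k).mp (hle hz)
  rw [Algebra.adjoin_singleton_eq_range_aeval, AlgHom.mem_range] at hz'
  obtain ⟨f, rfl⟩ := hz'
  have hqm : (X ^ p - C (⟨t ^ p, ht⟩ : R) : R[X]).Monic := monic_X_pow_sub_C _ hp
  have hq1 : (X ^ p - C (⟨t ^ p, ht⟩ : R) : R[X]) ≠ 1 := by
    intro h
    have h' := congrArg natDegree h
    rw [natDegree_X_pow_sub_C, natDegree_one] at h'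
    exact hp h'
  have hqt : aeval t (X ^ p - C (⟨t ^ p, ht⟩ : R) : R[X]) = 0 := by
    rw [map_sub, map_pow, aeval_X, aeval_C, sub_eq_zero]
    rfl
  have hdeg : (f %ₘ (X ^ p - C (⟨t ^ p, ht⟩ : R))).natDegree < p := by
    have h := natDegree_modByMonic_lt f hqm hq1
    rwa [natDegree_X_pow_sub_C] at h
  refine ⟨fun i => ((f %ₘ (X ^ p - C (⟨t ^ p, ht⟩ : R))).coeff i : K),
    fun i => ((f %ₘ (X ^ p - C (⟨t ^ p, ht⟩ : R))).coeff i).2, ?_⟩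
  rw [← aeval_modByMonic_eq_self_of_root (p := f) hqt, aeval_eq_sum_range' hdeg,
    Finset.sum_range]
  simp only [Algebra.smul_def]
  rfl

/-- **The residue computation.** With `t ^ p = u ∈ R` and `v(u - c ^ p) = 1` for all
`c ∈ O ∩ Frac R`: the polynomial `X ^ p - ū` is irreducible over the residue field `κ_M` of
`Frac R` (`X_pow_sub_C_irreducible_of_prime`), so `1, t̄, …, t̄^{p-1}` are linearly independent
over `κ_M`; consequently, if `∑_{i<p} rᵢ tⁱ ∈ 𝔪_O` with `rᵢ ∈ R`, then every `rᵢ ∈ 𝔪_O`.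
[folklore] -/
theorem residueStep_valuation_coeff_lt_one (O : ValuationSubring K) (R : Subalgebra k K)
    (hRO : R.toSubring ≤ O.toSubring) {p : ℕ} (hp : p.Prime) {t u : K} (htO : t ∈ O)
    (huR : u ∈ R) (htp : t ^ p = u)
    (hc : ∀ c : K, c ∈ O → c ∈ Subfield.closure (R : Set K) → O.valuation (u - c ^ p) = 1)
    (r : Fin p → K) (hr : ∀ i, r i ∈ R) (hz : O.valuation (∑ i, r i * t ^ (i : ℕ)) < 1) :
    ∀ i, O.valuation (r i) < 1 := by
  classical
  -- the residue field `κ_M` of `M = Frac R`, a subfield of the residue field `κ` of `O`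
  let κM : Subfield (ResidueField O) := resField O (Subfield.closure (R : Set K))
  have hrO : ∀ i, r i ∈ O := fun i => hRO (hr i)
  have hrM : ∀ i, residue O ⟨r i, hrO i⟩ ∈ κM :=
    fun i => residue_mem_resField O ⟨r i, hrO i⟩ (Subfield.subset_closure (hr i))
  have huO : u ∈ O := hRO huR
  have huM : residue O ⟨u, huO⟩ ∈ κM :=
    residue_mem_resField O ⟨u, huO⟩ (Subfield.subset_closure huR)
  -- `X ^ p - ū` is irreducible over `κ_M`
  have hirr : Irreducible (X ^ p - C (⟨residue O ⟨u, huO⟩, huM⟩ : κM) : κM[X]) := by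
    refine X_pow_sub_C_irreducible_of_prime hp fun b hb => ?_
    obtain ⟨c, hcM, hcb⟩ := (mem_resField_iff O _ (b : ResidueField O)).mp b.2
    have h1 := hc c c.2 hcM
    have hb' : (b : ResidueField O) ^ p = residue O ⟨u, huO⟩ := by
      have h := congrArg ((↑) : κM → ResidueField O) hb
      simpa using h
    have h2 : residue O (⟨u, huO⟩ - c ^ p) = 0 := by
      rw [map_sub, map_pow, hcb, hb', sub_self]
    rw [residue_eq_zero_iff, ValuationSubring.valuation_lt_one_iff] at h2
    exact (ne_of_lt h2) h1
  -- so it is the minimal polynomial of `t̄`, whose powers `t̄ⁱ`, `i < p`, are independent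
  have haeval : aeval (residue O ⟨t, htO⟩) (X ^ p - C (⟨residue O ⟨u, huO⟩, huM⟩ : κM) : κM[X]) =
      0 := by
    rw [map_sub, map_pow, aeval_X, aeval_C, sub_eq_zero, ← map_pow]
    change residue O (⟨t, htO⟩ ^ p) = residue O ⟨u, huO⟩
    congr 1
    exact Subtype.ext htp
  have hmin := minpoly.eq_of_irreducible_of_monic hirr haeval (monic_X_pow_sub_C _ hp.ne_zero)
  have hdeg : (minpoly κM (residue O ⟨t, htO⟩)).natDegree = p := by
    rw [← hmin, natDegree_X_pow_sub_C]
  have hli : LinearIndependent κM fun i : Fin p => residue O ⟨t, htO⟩ ^ (i : ℕ) := by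
    have h := linearIndependent_pow (K := κM) (residue O ⟨t, htO⟩)
    rwa [hdeg] at h
  -- the residue of `z = ∑ rᵢ tⁱ ∈ 𝔪_O` vanishes
  have hzO : (∑ i, r i * t ^ (i : ℕ)) ∈ O :=
    sum_mem fun i _ => mul_mem (hrO i) (pow_mem htO _)
  have hres0 : residue O ⟨_, hzO⟩ = 0 := by
    rw [residue_eq_zero_iff, ValuationSubring.valuation_lt_one_iff]
    exact hz
  have hO : (⟨_, hzO⟩ : O) = ∑ i, (⟨r i, hrO i⟩ : O) * ⟨t, htO⟩ ^ (i : ℕ) :=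
    Subtype.ext (by push_cast; rfl)
  rw [hO, map_sum] at hres0
  simp only [map_mul, map_pow] at hres0
  have hsmul : ∀ i, (⟨residue O ⟨r i, hrO i⟩, hrM i⟩ : κM) • residue O ⟨t, htO⟩ ^ (i : ℕ) =
      residue O ⟨r i, hrO i⟩ * residue O ⟨t, htO⟩ ^ (i : ℕ) :=
    fun i => rfl
  have hsum : ∑ i, (⟨residue O ⟨r i, hrO i⟩, hrM i⟩ : κM) • residue O ⟨t, htO⟩ ^ (i : ℕ) = 0 := by
    simp only [hsmul]
    exact hres0
  intro i
  have h0 := Fintype.linearIndependent_iff.mp hli _ hsum i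
  have h0' : residue O ⟨r i, hrO i⟩ = 0 := congrArg Subtype.val h0
  rw [residue_eq_zero_iff, ValuationSubring.valuation_lt_one_iff] at h0'
  exact h0'

end Helpers

/-- **The residue step of an `α_p`-tower** (registered stub `stub_residueStep`, S5 of reshape
v6 of line `pfaff-line-log-final-forms`). On a very good chart `(R, x)` (`R ⊆ O` finitely
generated over `k`, centre generated by `x₁, …, xₙ`), let `t ^ p = u ∈ R` with `v(u) = 1` and
`v(u - c ^ p) = 1` for all `c ∈ O ∩ Frac R` (the residue of `u` is not a `p`-th power in the
residue field of `Frac R`). Then `R' := R[t]` with the same `x` is a very good chart: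
`R ≤ R' ∋ t`, `R'` finitely generated, `R' ⊆ O`, `R' ⊆ Frac R (t)`, and the centre of `R'` is
generated by the `xᵢ` — every `z ∈ R[t]` is `∑_{i<p} rᵢ tⁱ`, `rᵢ ∈ R`, and if `z ∈ 𝔪_O` then
all `rᵢ ∈ 𝔪_O ∩ R = (x) R` because `1, t̄, …, t̄^{p-1}` are linearly independent over the
residue field of `Frac R` (`X ^ p - ū` irreducible, `X_pow_sub_C_irreducible_of_prime`).
[folklore] -/
theorem stub_residueStep :
    ∀ p : ℕ, p.Prime → ∀ (k K : Type) [Field k] [Field K] [Algebra k K] (O : ValuationSubring K) (n : ℕ) (R : Subalgebra k K) (hRO : R.toSubring ≤ O.toSubring) (x : Fin n → K) (hx : ∀ i, x i ∈ R), R.FG → Ideal.span (Set.range fun i => (⟨x i, hx i⟩ : R.toSubring)) = Ideal.comap (Subring.inclusion hRO) (IsLocalRing.maximalIdeal O) → ∀ (t u : K), u ∈ R → O.valuation u = 1 → t ^ p = u → (∀ c : K, c ∈ O → c ∈ Subfield.closure (R : Set K) → O.valuation (u - c ^ p) = 1) → ∃ (R' : Subalgebra k K) (hR'O : R'.toSubring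 ≤ O.toSubring) (hx' : ∀ i, x i ∈ R'), R ≤ R' ∧ t ∈ R' ∧ R'.FG ∧ ((R' : Set K) ⊆ Subfield.closure ((R : Set K) ∪ {t})) ∧ Ideal.span (Set.range fun i => (⟨x i, hx' i⟩ : R'.toSubring)) = Ideal.comap (Subring.inclusion hR'O) (IsLocalRing.maximalIdeal O) := by
  classical
  intro p hp k K _ _ _ O n R hRO x hx hRfg hcen t u huR hvu htp hc
  -- (0) `t` is a unit of `O`
  have hvt : O.valuation t = 1 := by
    have h : O.valuation t ^ p = 1 := by rw [← map_pow, htp, hvu]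
    exact (pow_eq_one_iff_of_nonneg zero_le hp.ne_zero).mp h
  have htO : t ∈ O := (O.valuation_le_one_iff t).mp hvt.le
  have htpR : t ^ p ∈ R := by rw [htp]; exact huR
  -- the chart `R' = R[t]`
  let R' : Subalgebra k K := Algebra.adjoin k (insert t (R : Set K))
  have hR'O : R'.toSubring ≤ O.toSubring := adjoin_insert_toSubring_le O.toSubring R hRO htO
  have hRR' : R ≤ R' := le_adjoin_insert R t
  have hRR'' : R.toSubring ≤ R'.toSubring := fun _ hz => hRR' hz
  have htR' : t ∈ R' := mem_adjoin_insert R t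
  have hx' : ∀ i, x i ∈ R' := fun i => hRR' (hx i)
  refine ⟨R', hR'O, hx', hRR', htR', fg_adjoin_insert hRfg t, ?_, ?_⟩
  · -- `R[t] ⊆ Frac R (t)`
    have h := adjoin_insert_toSubring_le (Subfield.closure ((R : Set K) ∪ {t})).toSubring R
      (fun z hz => Subfield.subset_closure (Or.inl hz)) (Subfield.subset_closure (Or.inr rfl))
    exact fun z hz => h hz
  · -- the centre of `R[t]` is generated by the `xᵢ`
    apply le_antisymm
    · rw [Ideal.span_le]
      rintro _ ⟨i, rfl⟩
      have hi : (⟨x i, hx i⟩ : R.toSubring) ∈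
          Ideal.comap (Subring.inclusion hRO) (maximalIdeal O) := by
        rw [← hcen]
        exact Ideal.subset_span ⟨i, rfl⟩
      rw [residueStep_mem_centre_iff] at hi
      show (⟨x i, hx' i⟩ : R'.toSubring) ∈ Ideal.comap (Subring.inclusion hR'O) (maximalIdeal O)
      rw [residueStep_mem_centre_iff]
      exact hi
    · intro z hz
      rw [residueStep_mem_centre_iff] at hz
      obtain ⟨r, hrR, hzr⟩ := residueStep_exists_sum_eq R hp.ne_zero htpR z.2
      have hvr : ∀ i, O.valuation (r i) < 1 :=
        residueStep_valuation_coeff_lt_one O R hRO hp htO huR htp hc r hrR (hzr ▸ hz)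
      -- each `rᵢ` lies in the centre of `R`, i.e. in `(x) R ⊆ (x) R[t]`
      have hrspan : ∀ i, (⟨r i, hRR' (hrR i)⟩ : R'.toSubring) ∈
          Ideal.span (Set.range fun i => (⟨x i, hx' i⟩ : R'.toSubring)) := by
        intro i
        have h1 : (⟨r i, hrR i⟩ : R.toSubring) ∈
            Ideal.comap (Subring.inclusion hRO) (maximalIdeal O) := by
          rw [residueStep_mem_centre_iff]
          exact hvr i
        rw [← hcen] at h1
        have h2 := Ideal.mem_map_of_mem (Subring.inclusion hRR'') h1
        rw [Ideal.map_span, ← Set.range_comp] at h2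
        exact h2
      have hzeq : z = ∑ i, (⟨r i, hRR' (hrR i)⟩ : R'.toSubring) * ⟨t, htR'⟩ ^ (i : ℕ) :=
        Subtype.ext (by push_cast; exact hzr)
      rw [hzeq]
      exact Ideal.sum_mem _ fun i _ => Ideal.mul_mem_right _ _ (hrspan i)

end Summit.ResolutionOfSingularities.ResolutionOfSingularities.Theorems.PfaffLine
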